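import Literature.Geometry.Symplectic.TwistingHomotopyProofs
import Literature.Geometry.Symplectic.SteinDomainShrinking
import Literature.Topology.FourManifolds.BoundaryFlowout
import Mathlib.Analysis.Calculus.ContDiff.Operations
import Mathlib.Analysis.Normed.Module.Alternating.Curry
import Mathlib.Geometry.Manifold.VectorBundle.ContMDiffSection
import Mathlib.Analysis.SpecialFunctions.SmoothTransition
import HarnessLib

/-!
# The normalised Liouville field of a Stein domain and its boundary flow-out input

Topic `Literature/Geometry/Symplectic`; proofs file of the fact seat of
`Literature.Geometry.Symplectic.Gompf1998_thm13_twoHandles` (**E2**, `SteinTwoHandles.lean`),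
step "Gray transport along the levels of `φ`".  `SteinLiouville.lean` proves that a Stein
domain `(W, J, φ)` is a Liouville domain for `λ = -d^ℂφ = -dφ ∘ J` (`SteinStructure.contactForm`;
`ω = dλ = -dd^ℂφ` is `SteinStructure.kahlerForm`, non-degenerate on all of `TW` because
`ω(v, Jv) > 0`).  Here the **Liouville vector field** `Y` (`ι_Y ω = λ`) is introduced as an
honest vector field and normalised to unit `φ`-speed:

* §1 `SteinStructure.kahlerFlat` / `kahlerFlatEquiv` — `v ↦ ω_x(v, ·)`, a linear isomorphism
  `T_xW ≅ T_x^*W` (non-degeneracy + dimension count); `SteinStructure.liouvilleVF` — the Liouville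
  field `Y_x = (ω_x^♭)⁻¹(λ_x)`, with `ω(Y, w) = λ(w)`, `λ(Y) = 0`, `dφ(Y) = ω(Y, JY) ≥ 0`,
  `Y_x = 0 ↔ dφ_x = 0`, `dφ(Y) > 0` off the critical set (all pointwise linear algebra, as in the
  proof of `SteinStructure.isLiouvilleDomain`);
* §2 `SteinStructure.normLiouvilleVF` — `Z = Y / dφ(Y)`: `dφ(Z) = 1`, `λ(Z) = 0` and
  `ι_Z ω = dφ(Y)⁻¹ • λ` off the critical set.  Consequently `L_Z λ = ι_Z dλ + d(λ(Z))` is a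
  multiple of `λ` and `L_Z dφ = d(dφ(Z)) = 0`: the flow of `Z` maps levels of `φ` to levels of
  `φ` and the complex tangencies `ξ = ker dφ ∩ ker λ` of one level onto those of the others (Gray
  stability for the levels of a `J`-convex function, realised by a Liouville-type flow; carried
  out in `SteinLevelTransport.lean`);
* §3 `isSmoothVectorField_liouvilleVF` — **`Y` is a smooth vector field**: in the trivialization
  of `TW` at `x₀` it reads `y ↦ (Ω̂(y)^♭)⁻¹ (Λ̂(y))` with `Λ̂`, `Ω̂` the chart representatives of
  the smooth forms `λ`, `ω = dλ` (`MForm.apply_eq_inChart_apply`,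
  `MForm.SmoothAt.contDiffWithinAt_inChart`), inversion being smooth
  (`contDiffAt_map_inverse`);
* §4 `SteinStructure.liouvilleFlowout` — **the flow-out input** (`FlowoutInput 3 W` of
  `BoundaryFlowout.lean`) with boundary-defining function `f = max φ - φ` and field
  `ξ = -χ(φ) • Z`, `χ(t) = smoothTransition ((t - c₀)/(c₁ - c₀))` a smooth cut-off equal to `1`
  on `{φ ≥ c₁}` and to `0` below the critical values of `φ`; `ξ(f) = 1` on `{f ≤ max φ - c₁}`.  Its flow-out `Fl` (Milnor's collar flow)
  is the level-preserving contact isotopy used to shrink `W` to `{φ ≤ c}` while keeping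
  Legendrian attaching circles Legendrian (`SteinDomainPush.lean`, `SteinLevelTransport.lean`).

Everything is **proved**; no named fact is introduced.

## References

* K. Cieliebak, Ya. Eliashberg, *From Stein to Weinstein and Back*, AMS Colloquium Publ. 59
  (2012), §2 (`J`-convex functions, `ω_φ = -dd^ℂφ`, the Liouville field of `λ_φ = -d^ℂφ`),
  §11.1 (Liouville domains). [CieliebakEliashberg2012]
* Ya. Eliashberg, *Topological characterization of Stein manifolds of dimension > 2*, Internat.
  J. Math. 1 (1990), §1. [Eliashberg1990Stein]
* J. Milnor, *Lectures on the h-cobordism theorem* (1965), proof of Thm. 3.4 (the normalised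
  field `ξ(f) = 1` and its flow-out). [MilnorHCobordism1965]
-/

noncomputable section

open scoped Manifold ContDiff Topology Bundle
open Set Function Bundle Filter

namespace Literature.Geometry.Symplectic

open Literature.Geometry.Kaehler Literature.Topology.FourManifolds

/-- The model vector space `ℝ⁴` of the tangent spaces. [folklore] -/
local notation "E4" => EuclideanSpace ℝ (Fin 4)

/-! ### §0 Linear algebra of alternating `1`- and `2`-forms on a normed space -/

section Flat

variable {E : Type*} [NormedAddCommGroup E] [NormedSpace ℝ E]

/-- A continuous alternating `1`-form as a continuous linear functional (the inverse of
Mathlib's isometry `ContinuousAlternatingMap.ofSubsingletonLIE`), as a continuous linear map in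
the form. [folklore] -/
def alt1ToCLM : (E [⋀^Fin 1]→L[ℝ] ℝ) →L[ℝ] (E →L[ℝ] ℝ) :=
  ((ContinuousAlternatingMap.ofSubsingletonLIE (𝕜 := ℝ) (E := E) (F := ℝ)
    (0 : Fin 1)).symm.toContinuousLinearEquiv : (E [⋀^Fin 1]→L[ℝ] ℝ) →L[ℝ] (E →L[ℝ] ℝ))

/-- `alt1ToCLM α u = α ![u]`. [folklore] -/
@[simp] theorem alt1ToCLM_apply (α : E [⋀^Fin 1]→L[ℝ] ℝ) (u : E) : alt1ToCLM α u = α ![u] := by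
  have h1 : (ContinuousAlternatingMap.ofSubsingletonLIE (𝕜 := ℝ) (E := E) (F := ℝ) (0 : Fin 1))
      (alt1ToCLM α) = α := LinearIsometryEquiv.apply_symm_apply _ α
  have h2 := congrArg (fun β : E [⋀^Fin 1]→L[ℝ] ℝ => β ![u]) h1
  rw [← h2]
  rfl

/-- **The flat map of an alternating `2`-form**: `M^♭ v = (u ↦ M(v, u))` (Mathlib's
`curryLeft` followed by `alt1ToCLM`). [folklore] -/
def alt2Flat (M : E [⋀^Fin 2]→L[ℝ] ℝ) : E →L[ℝ] (E →L[ℝ] ℝ) :=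
  (alt1ToCLM (E := E)).comp M.curryLeft

/-- `alt2Flat M v u = M ![v, u]`. [folklore] -/
@[simp] theorem alt2Flat_apply (M : E [⋀^Fin 2]→L[ℝ] ℝ) (v u : E) : alt2Flat M v u = M ![v, u] := by
  simp only [alt2Flat, ContinuousLinearMap.coe_comp, Function.comp_apply, alt1ToCLM_apply,
    ContinuousAlternatingMap.curryLeft_apply_apply]

/-- `M ↦ M^♭` is a bounded linear map (`‖M^♭‖ ≤ ‖M‖`). [folklore] -/
theorem isBoundedLinearMap_alt2Flat :
    IsBoundedLinearMap ℝ (alt2Flat : (E [⋀^Fin 2]→L[ℝ] ℝ) → E →L[ℝ] (E →L[ℝ] ℝ)) where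
  map_add M N := by ext v u; simp
  map_smul c M := by ext v u; simp
  bound := by
    refine ⟨1, one_pos, fun M => ?_⟩
    rw [one_mul]
    refine ContinuousLinearMap.opNorm_le_bound _ (norm_nonneg _) fun v => ?_
    refine ContinuousLinearMap.opNorm_le_bound _ (by positivity) fun u => ?_
    rw [alt2Flat_apply]
    calc ‖M ![v, u]‖ ≤ ‖M‖ * ∏ i, ‖(![v, u] : Fin 2 → E) i‖ := M.le_opNorm _
      _ = ‖M‖ * ‖v‖ * ‖u‖ := by
        rw [Fin.prod_univ_two, Matrix.cons_val_zero, Matrix.cons_val_one,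
          Matrix.cons_val_fin_one, mul_assoc]

/-- `M ↦ M^♭` is smooth. [folklore] -/
theorem contDiff_alt2Flat {n : WithTop ℕ∞} :
    ContDiff ℝ n (alt2Flat : (E [⋀^Fin 2]→L[ℝ] ℝ) → E →L[ℝ] (E →L[ℝ] ℝ)) :=
  isBoundedLinearMap_alt2Flat.contDiff

variable [FiniteDimensional ℝ E]

/-- In finite dimension, an injective flat map `E → E^*` is a linear isomorphism (dimension
count: `dim E^* = dim E`). [folklore] -/
theorem exists_continuousLinearEquiv_eq_of_injective {A : E →L[ℝ] (E →L[ℝ] ℝ)}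
    (hA : Injective A) : ∃ e : E ≃L[ℝ] (E →L[ℝ] ℝ), (e : E →L[ℝ] (E →L[ℝ] ℝ)) = A := by
  have hdim : Module.finrank ℝ E = Module.finrank ℝ (E →L[ℝ] ℝ) := by
    rw [← (LinearMap.toContinuousLinearMap : (E →ₗ[ℝ] ℝ) ≃ₗ[ℝ] (E →L[ℝ] ℝ)).finrank_eq]
    exact (Subspace.dual_finrank_eq).symm
  have hA' : Injective (A : E →ₗ[ℝ] (E →L[ℝ] ℝ)) := hA
  set e₀ : E ≃ₗ[ℝ] (E →L[ℝ] ℝ) :=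
    LinearMap.linearEquivOfInjective (A : E →ₗ[ℝ] (E →L[ℝ] ℝ)) hA' hdim with he₀
  refine ⟨e₀.toContinuousLinearEquiv, ?_⟩
  ext v u
  show (e₀ v) u = A v u
  rw [he₀, LinearMap.linearEquivOfInjective_apply]
  rfl

/-- **Smoothness of `y ↦ (Ω(y)^♭)⁻¹ Λ(y)`**: if `Ω` (`2`-forms) and `Λ` (`1`-forms) are `C^n`
within `s` at `y` and `Ω(y)^♭` is injective, then so is `y ↦ (Ω(y)^♭)⁻¹ (Λ(y))`
(`contDiffAt_map_inverse` at the invertible `Ω(y)^♭`). [folklore] -/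
theorem contDiffWithinAt_inverse_alt2Flat_apply [CompleteSpace E] {E' : Type*}
    [NormedAddCommGroup E'] [NormedSpace ℝ E'] {n : WithTop ℕ∞}
    {Ω : E' → E [⋀^Fin 2]→L[ℝ] ℝ} {Λ : E' → E [⋀^Fin 1]→L[ℝ] ℝ} {s : Set E'} {y : E'}
    (hΩ : ContDiffWithinAt ℝ n Ω s y) (hΛ : ContDiffWithinAt ℝ n Λ s y)
    (hinj : Injective (alt2Flat (Ω y))) :
    ContDiffWithinAt ℝ n (fun y' => (alt2Flat (Ω y')).inverse (alt1ToCLM (Λ y'))) s y := by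
  obtain ⟨e, he⟩ := exists_continuousLinearEquiv_eq_of_injective hinj
  have h1 : ContDiffWithinAt ℝ n (fun y' => alt2Flat (Ω y')) s y :=
    contDiff_alt2Flat.comp_contDiffWithinAt hΩ
  have h2 : ContDiffWithinAt ℝ n (fun y' => (alt2Flat (Ω y')).inverse) s y := by
    have hi : ContDiffAt ℝ n ContinuousLinearMap.inverse (alt2Flat (Ω y)) := by
      rw [← he]; exact contDiffAt_map_inverse e
    exact ContDiffAt.comp_contDiffWithinAt (g := ContinuousLinearMap.inverse)
      (f := fun y' => alt2Flat (Ω y')) y hi h1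
  have h3 : ContDiffWithinAt ℝ n (fun y' => alt1ToCLM (Λ y')) s y :=
    (alt1ToCLM (E := E)).contDiff.comp_contDiffWithinAt hΛ
  exact h2.clm_apply h3

/-- If `A^♭` is injective and `A^♭ v = θ`, then `v = (A^♭)⁻¹ θ`. [folklore] -/
theorem eq_inverse_of_apply_eq {A : E →L[ℝ] (E →L[ℝ] ℝ)} (hA : Injective A) {v : E}
    {θ : E →L[ℝ] ℝ} (h : A v = θ) : v = A.inverse θ := by
  obtain ⟨e, rfl⟩ := exists_continuousLinearEquiv_eq_of_injective hA
  rw [ContinuousLinearMap.inverse_equiv]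
  have : e v = θ := h
  rw [← this, ContinuousLinearEquiv.coe_coe, e.symm_apply_apply]

end Flat

/-! ### A bridge: functions of the extended chart -/

section ChartComp

variable {E : Type*} [NormedAddCommGroup E] [NormedSpace ℝ E] {H : Type*} [TopologicalSpace H]
  {I : ModelWithCorners ℝ E H} {M : Type*} [TopologicalSpace M] [ChartedSpace H M]
  [IsManifold I ∞ M] {F : Type*} [NormedAddCommGroup F] [NormedSpace ℝ F]

omit [IsManifold I ∞ M] in
/-- **A function of the chart is smooth if it is smooth within `range I` in the chart**: for
`g : E → F` of class `C^∞` within `range I` at `extChartAt I x₁ x₁`, the function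
`g ∘ extChartAt I x₁` is `C^∞` at `x₁` (Mathlib's `ContDiffWithinAt.comp_contMDiffWithinAt`
with `contMDiffAt_extChartAt`). [folklore] -/
theorem contMDiffAt_comp_extChartAt {g : E → F} {x₁ : M}
    (hg : ContDiffWithinAt ℝ ∞ g (range I) (extChartAt I x₁ x₁)) :
    ContMDiffAt I 𝓘(ℝ, F) ∞ (g ∘ extChartAt I x₁) x₁ := by
  have h := hg.comp_contMDiffWithinAt (s := univ) (contMDiffAt_extChartAt (I := I) (x := x₁))
    (fun x _ => by
      show extChartAt I x₁ x ∈ range I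
      rw [extChartAt_coe]
      exact mem_range_self _)
  exact contMDiffWithinAt_univ.1 h

end ChartComp

namespace SteinStructure

variable {W : Type*} [TopologicalSpace W] [ChartedSpace (EuclideanHalfSpace 4) W]
  [IsManifold (𝓡∂ 4) ∞ W] [CompactSpace W] (S : SteinStructure W)

/-! ### §1 The Liouville vector field -/

/-- **The flat map `ω_x^♭ : v ↦ ω_x(v, ·)` of the Kähler form**, as a linear map
`T_xW → T_x^*W`. [cite: CieliebakEliashberg2012, §2] -/
def kahlerFlat (x : W) : E4 →ₗ[ℝ] (E4 →ₗ[ℝ] ℝ) :=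
  LinearMap.mk₂ ℝ (S.kahlerForm x) (S.kahlerForm_add_left x)
    (fun c u v => by rw [S.kahlerForm_smul_left, smul_eq_mul])
    (S.kahlerForm_add_right x) (fun c u v => by rw [S.kahlerForm_smul_right, smul_eq_mul])

/-- `kahlerFlat x v w = ω_x(v, w)`. [folklore] -/
@[simp] theorem kahlerFlat_apply (x : W) (v w : E4) : S.kahlerFlat x v w = S.kahlerForm x v w :=
  rfl

/-- **`ω_x^♭` is injective**: `ω = dλ` is non-degenerate (`J`-convexity, `ω(v, Jv) > 0`;
`IsLiouvilleDomain.nondegenerate` of `SteinStructure.isLiouvilleDomain`).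
[cite: CieliebakEliashberg2012, §2] -/
theorem kahlerFlat_injective [T2Space W] (x : W) : Injective (S.kahlerFlat x) := by
  refine (injective_iff_map_eq_zero _).2 fun v hv => ?_
  refine S.isLiouvilleDomain.nondegenerate x v fun w => ?_
  rw [S.mextDeriv_liouvilleForm_apply]
  exact LinearMap.congr_fun hv w

/-- **`ω_x^♭ : T_xW ≅ T_x^*W`** (injective between spaces of the same dimension).
[cite: CieliebakEliashberg2012, §2] -/
def kahlerFlatEquiv [T2Space W] (x : W) : E4 ≃ₗ[ℝ] (E4 →ₗ[ℝ] ℝ) :=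
  LinearMap.linearEquivOfInjective (S.kahlerFlat x) (S.kahlerFlat_injective x)
    (Subspace.dual_finrank_eq).symm

/-- `kahlerFlatEquiv` is `kahlerFlat`. [folklore] -/
@[simp] theorem kahlerFlatEquiv_apply [T2Space W] (x : W) (v : E4) :
    S.kahlerFlatEquiv x v = S.kahlerFlat x v :=
  LinearMap.linearEquivOfInjective_apply _ _ v

variable [T2Space W]

/-- **The Liouville vector field `Y` of the Stein structure**: the `ω`-dual of the Liouville
form, `ι_Y ω = λ` (`λ = α = -dφ ∘ J`, `SteinStructure.contactForm`).
[cite: CieliebakEliashberg2012, §2 and §11.1] -/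
def liouvilleVF (x : W) : E4 :=
  (S.kahlerFlatEquiv x).symm ((S.contactForm x : E4 →L[ℝ] ℝ) : E4 →ₗ[ℝ] ℝ)

/-- **Defining identity of the Liouville field**: `ω(Y, w) = λ(w)`. [cite: CieliebakEliashberg2012, §11.1] -/
theorem kahlerForm_liouvilleVF (x : W) (w : E4) :
    S.kahlerForm x (S.liouvilleVF x) w = S.contactForm x w := by
  have h : S.kahlerFlatEquiv x (S.liouvilleVF x) =
      ((S.contactForm x : E4 →L[ℝ] ℝ) : E4 →ₗ[ℝ] ℝ) := by
    rw [liouvilleVF, LinearEquiv.apply_symm_apply]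
  have h' := LinearMap.congr_fun h w
  exact h'

/-- Uniqueness: a vector `v` with `ω(v, ·) = λ` is the Liouville vector. [folklore] -/
theorem eq_liouvilleVF_of_forall (x : W) {v : E4} (h : ∀ w, S.kahlerForm x v w = S.contactForm x w) :
    v = S.liouvilleVF x := by
  apply S.kahlerFlat_injective x
  ext w
  rw [kahlerFlat_apply, kahlerFlat_apply, h w, kahlerForm_liouvilleVF]

/-- **`λ(Y) = ω(Y, Y) = 0`.** [cite: CieliebakEliashberg2012, §11.1] -/
theorem contactForm_liouvilleVF (x : W) : S.contactForm x (S.liouvilleVF x) = 0 := by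
  rw [← S.kahlerForm_liouvilleVF, S.kahlerForm_self]

/-- **`dφ(Y) = ω(Y, JY)`**: `λ(JY) = -dφ(J²Y) = dφ(Y)` and `λ(JY) = ω(Y, JY)`.
[cite: CieliebakEliashberg2012, §2] -/
theorem dφ_liouvilleVF_eq (x : W) :
    S.dφ x (S.liouvilleVF x) = S.kahlerForm x (S.liouvilleVF x) (S.J x (S.liouvilleVF x)) := by
  rw [S.kahlerForm_liouvilleVF, contactForm_apply, S.J_sq, map_neg, neg_neg]

/-- `dφ(Y) ≥ 0`. [folklore] -/
theorem dφ_liouvilleVF_nonneg (x : W) : 0 ≤ S.dφ x (S.liouvilleVF x) := by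
  rw [S.dφ_liouvilleVF_eq]
  by_cases h : S.liouvilleVF x = 0
  · rw [h, map_zero, S.kahlerForm_self]
  · exact (S.kahlerForm_self_J_pos x h).le

/-- **`Y_x = 0` exactly at the critical points of `φ`** (`λ_x = -dφ_x ∘ J_x` vanishes iff `dφ_x`
does, `J_x` being invertible). [folklore] -/
theorem liouvilleVF_eq_zero_iff (x : W) : S.liouvilleVF x = 0 ↔ S.dφ x = 0 := by
  constructor
  · intro h
    ext w
    have h1 := S.kahlerForm_liouvilleVF x (S.J x (-w))
    rw [h, contactForm_apply, S.J_sq, neg_neg] at h1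
    have h2 : S.kahlerForm x 0 (S.J x (-w)) = 0 := by
      have := S.kahlerForm_smul_left x (0 : ℝ) 0 (S.J x (-w))
      simpa using this
    rw [h2] at h1
    simpa using h1
  · intro h
    symm
    refine S.eq_liouvilleVF_of_forall x fun w => ?_
    have h0 : S.kahlerForm x 0 w = 0 := by
      have := S.kahlerForm_smul_left x (0 : ℝ) 0 w
      simpa using this
    rw [h0, contactForm_apply]
    show (0 : ℝ) = -(S.dφ x (S.J x w))
    rw [h]; simp

/-- **`dφ(Y) > 0` off the critical set of `φ`.** [cite: CieliebakEliashberg2012, §2] -/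
theorem dφ_liouvilleVF_pos {x : W} (hx : S.dφ x ≠ 0) : 0 < S.dφ x (S.liouvilleVF x) := by
  rw [S.dφ_liouvilleVF_eq]
  exact S.kahlerForm_self_J_pos x fun h => hx ((S.liouvilleVF_eq_zero_iff x).1 h)

/-- `dφ(Y) ≠ 0` iff `dφ ≠ 0`. [folklore] -/
theorem dφ_liouvilleVF_ne_zero_iff (x : W) : S.dφ x (S.liouvilleVF x) ≠ 0 ↔ S.dφ x ≠ 0 := by
  constructor
  · intro h h0
    exact h (by rw [h0]; rfl)
  · intro h
    exact (S.dφ_liouvilleVF_pos h).ne'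

/-! ### §2 The normalised Liouville field `Z = Y / dφ(Y)` -/

/-- **The normalised Liouville field** `Z = dφ(Y)⁻¹ • Y` (unit `φ`-speed; it is `0` at the
critical points of `φ`, where `Y = 0`). [cite: CieliebakEliashberg2012, §2] -/
def normLiouvilleVF (x : W) : E4 :=
  (S.dφ x (S.liouvilleVF x))⁻¹ • S.liouvilleVF x

/-- **`dφ(Z) = 1` off the critical set.** [folklore] -/
theorem dφ_normLiouvilleVF {x : W} (hx : S.dφ x ≠ 0) : S.dφ x (S.normLiouvilleVF x) = 1 := by
  rw [normLiouvilleVF, map_smul, smul_eq_mul, inv_mul_cancel₀ ((S.dφ_liouvilleVF_ne_zero_iff x).2 hx)]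

/-- **`λ(Z) = 0`.** [folklore] -/
theorem contactForm_normLiouvilleVF (x : W) : S.contactForm x (S.normLiouvilleVF x) = 0 := by
  rw [normLiouvilleVF, map_smul, S.contactForm_liouvilleVF, smul_zero]

/-- **`ι_Z ω = dφ(Y)⁻¹ • λ`**: `ω(Z, w) = dφ(Y)⁻¹ λ(w)`. [folklore] -/
theorem kahlerForm_normLiouvilleVF (x : W) (w : E4) :
    S.kahlerForm x (S.normLiouvilleVF x) w = (S.dφ x (S.liouvilleVF x))⁻¹ * S.contactForm x w := by
  rw [normLiouvilleVF, S.kahlerForm_smul_left, S.kahlerForm_liouvilleVF]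

/-- `Z` and `Y` span the same line: `Y = dφ(Y) • Z` off the critical set. [folklore] -/
theorem liouvilleVF_eq_smul_normLiouvilleVF {x : W} (hx : S.dφ x ≠ 0) :
    S.liouvilleVF x = S.dφ x (S.liouvilleVF x) • S.normLiouvilleVF x := by
  rw [normLiouvilleVF, smul_smul, mul_inv_cancel₀ ((S.dφ_liouvilleVF_ne_zero_iff x).2 hx), one_smul]

/-! ### §3 Smoothness of the Liouville field -/

/-- **The Liouville field read in the trivialization at `x₀`.**  For `x` in the chart domain of
`x₀`, with `y = c x`, `e` the trivialization of `TW` at `x₀`, `Λ̂ = λ.inChart x₀` and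
`Ω̂ = (dλ).inChart x₀`:  `(e ⟨x, Y_x⟩).2 = (Ω̂(y)^♭)⁻¹ (Λ̂(y))` — the defining identity
`ω_x(Y_x, w) = λ_x(w)` read through `MForm.apply_eq_inChart_apply`. [folklore] -/
theorem trivializationAt_liouvilleVF_eq {x₀ x : W}
    (hx : x ∈ (chartAt (EuclideanHalfSpace 4) x₀).source) :
    ((trivializationAt E4 (TangentSpace (𝓡∂ 4)) x₀) (⟨x, S.liouvilleVF x⟩ : TangentBundle (𝓡∂ 4) W)).2 =
      (alt2Flat ((mextDeriv (-dComplex S.J S.φ)).inChart x₀ (extChartAt (𝓡∂ 4) x₀ x))).inverse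
        (alt1ToCLM ((-dComplex S.J S.φ).inChart x₀ (extChartAt (𝓡∂ 4) x₀ x))) := by
  set e := trivializationAt E4 (TangentSpace (𝓡∂ 4)) x₀ with he
  set lam : MForm (𝓡∂ 4) W ℝ 1 := -dComplex S.J S.φ with hlam
  set y := extChartAt (𝓡∂ 4) x₀ x with hy
  have hxb : x ∈ e.baseSet := hx
  -- the two chart identities
  have hΛ : ∀ w : E4, S.contactForm x w =
      (lam.inChart x₀ y) ![(e (⟨x, w⟩ : TangentBundle (𝓡∂ 4) W)).2] := fun w => by
    rw [← S.liouvilleForm_apply]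
    refine (MForm.apply_eq_inChart_apply lam hx ![w]).trans ?_
    congr 1
    funext i
    fin_cases i
    rfl
  have hΩ : ∀ v w : E4, S.kahlerForm x v w =
      ((mextDeriv lam).inChart x₀ y) ![(e (⟨x, v⟩ : TangentBundle (𝓡∂ 4) W)).2,
        (e (⟨x, w⟩ : TangentBundle (𝓡∂ 4) W)).2] := fun v w => by
    rw [← S.mextDeriv_liouvilleForm_apply]
    refine (MForm.apply_eq_inChart_apply (mextDeriv lam) hx ![v, w]).trans ?_
    congr 1
    funext i
    fin_cases i <;> rfl
  -- injectivity of `Ω̂(y)^♭`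
  have hinj : Injective (alt2Flat ((mextDeriv lam).inChart x₀ y)) := by
    refine (injective_iff_map_eq_zero _).2 fun v' hv' => ?_
    -- `v' = e ⟨x, v⟩` for `v = e.symmL x v'`
    set v : E4 := e.symmL ℝ x v' with hv
    have hvv : (e (⟨x, v⟩ : TangentBundle (𝓡∂ 4) W)).2 = v' := by
      rw [hv, e.symmL_apply hxb]
      exact congrArg Prod.snd (e.apply_mk_symm hxb v')
    have hv0 : v = 0 := by
      apply S.kahlerFlat_injective x
      ext w
      rw [LinearMap.map_zero, LinearMap.zero_apply, kahlerFlat_apply, hΩ, hvv]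
      have := DFunLike.congr_fun hv' (e (⟨x, w⟩ : TangentBundle (𝓡∂ 4) W)).2
      rwa [alt2Flat_apply, zero_apply] at this
    rw [← hvv, hv0]
    have h0 := e.zeroSection ℝ hxb
    show (e (zeroSection E4 (TangentSpace (𝓡∂ 4)) x)).2 = 0
    rw [h0]
  -- the identity `Ω̂(y)^♭ (e Y) = Λ̂(y)` tested on `u = e ⟨x, e.symmL x u⟩`
  refine eq_inverse_of_apply_eq hinj ?_
  ext u
  set w : E4 := e.symmL ℝ x u with hw
  have hwu : (e (⟨x, w⟩ : TangentBundle (𝓡∂ 4) W)).2 = u := by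
    rw [hw, e.symmL_apply hxb]
    exact congrArg Prod.snd (e.apply_mk_symm hxb u)
  rw [alt2Flat_apply, alt1ToCLM_apply, ← hwu, ← hΩ, ← hΛ, S.kahlerForm_liouvilleVF]

/-- **`Ω̂(y)^♭` is injective on the chart target** (non-degeneracy of `ω` read in the
trivialization). [folklore] -/
theorem alt2Flat_inChart_injective {x₀ x : W}
    (hx : x ∈ (chartAt (EuclideanHalfSpace 4) x₀).source) :
    Injective (alt2Flat ((mextDeriv (-dComplex S.J S.φ)).inChart x₀ (extChartAt (𝓡∂ 4) x₀ x))) := by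
  set e := trivializationAt E4 (TangentSpace (𝓡∂ 4)) x₀ with he
  set lam : MForm (𝓡∂ 4) W ℝ 1 := -dComplex S.J S.φ with hlam
  have hxb : x ∈ e.baseSet := hx
  have hΩ : ∀ v w : E4, S.kahlerForm x v w =
      ((mextDeriv lam).inChart x₀ (extChartAt (𝓡∂ 4) x₀ x)) ![(e (⟨x, v⟩ : TangentBundle (𝓡∂ 4) W)).2,
        (e (⟨x, w⟩ : TangentBundle (𝓡∂ 4) W)).2] := fun v w => by
    rw [← S.mextDeriv_liouvilleForm_apply]
    refine (MForm.apply_eq_inChart_apply (mextDeriv lam) hx ![v, w]).trans ?_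
    congr 1
    funext i
    fin_cases i <;> rfl
  refine (injective_iff_map_eq_zero _).2 fun v' hv' => ?_
  set v : E4 := e.symmL ℝ x v' with hv
  have hvv : (e (⟨x, v⟩ : TangentBundle (𝓡∂ 4) W)).2 = v' := by
    rw [hv, e.symmL_apply hxb]
    exact congrArg Prod.snd (e.apply_mk_symm hxb v')
  have hv0 : v = 0 := by
    apply S.kahlerFlat_injective x
    ext w
    rw [LinearMap.map_zero, LinearMap.zero_apply, kahlerFlat_apply, hΩ, hvv]
    have := DFunLike.congr_fun hv' (e (⟨x, w⟩ : TangentBundle (𝓡∂ 4) W)).2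
    rwa [alt2Flat_apply, zero_apply] at this
  rw [← hvv, hv0]
  have h0 := e.zeroSection ℝ hxb
  show (e (zeroSection E4 (TangentSpace (𝓡∂ 4)) x)).2 = 0
  rw [h0]

/-- **The Liouville vector field is smooth** (bundled form: `x ↦ (x, Y_x)` is a `C^∞` section
of `TW`).  At `x₁`, in the trivialization at `x₁` the field reads `y ↦ (Ω̂(y)^♭)⁻¹ (Λ̂(y))`
(`trivializationAt_liouvilleVF_eq`), which is `C^∞` within `range I` at the centre
(`contDiffWithinAt_inverse_alt2Flat_apply`, the representatives of the smooth forms `λ`, `dλ`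
being `C^∞` there); `Trivialization.contMDiffAt_section_iff` concludes.
[cite: CieliebakEliashberg2012, §2] -/
theorem contMDiff_liouvilleVF :
    ContMDiff (𝓡∂ 4) ((𝓡∂ 4).prod 𝓘(ℝ, E4)) ∞
      (fun x => (TotalSpace.mk' E4 x (S.liouvilleVF x) : TangentBundle (𝓡∂ 4) W)) := by
  intro x₁
  set e := trivializationAt E4 (TangentSpace (𝓡∂ 4)) x₁ with he
  set lam : MForm (𝓡∂ 4) W ℝ 1 := -dComplex S.J S.φ with hlam
  have hx₁ : x₁ ∈ (chartAt (EuclideanHalfSpace 4) x₁).source := mem_chart_source _ x₁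
  rw [e.contMDiffAt_section_iff hx₁]
  set g : E4 → E4 := fun y => (alt2Flat ((mextDeriv lam).inChart x₁ y)).inverse
    (alt1ToCLM (lam.inChart x₁ y)) with hg
  have hgs : ContDiffWithinAt ℝ ∞ g (range (𝓡∂ 4)) (extChartAt (𝓡∂ 4) x₁ x₁) := by
    have hΩ : ContDiffWithinAt ℝ ∞ ((mextDeriv lam).inChart x₁) (range (𝓡∂ 4))
        (extChartAt (𝓡∂ 4) x₁ x₁) :=
      (isSmoothForm_mextDeriv (inChart_mextDeriv_holds (𝓡∂ 4) W ℝ) S.isSmoothForm_liouvilleForm) x₁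
    have hΛ : ContDiffWithinAt ℝ ∞ (lam.inChart x₁) (range (𝓡∂ 4)) (extChartAt (𝓡∂ 4) x₁ x₁) :=
      S.isSmoothForm_liouvilleForm x₁
    exact contDiffWithinAt_inverse_alt2Flat_apply hΩ hΛ (S.alt2Flat_inChart_injective hx₁)
  have hcomp := contMDiffAt_comp_extChartAt (I := 𝓡∂ 4) hgs
  refine hcomp.congr_of_eventuallyEq ?_
  filter_upwards [(chartAt (EuclideanHalfSpace 4) x₁).open_source.mem_nhds hx₁] with x hx
  exact S.trivializationAt_liouvilleVF_eq hx

/-- `Y` is a smooth vector field in the sense of `SteinDomain.lean`. [folklore] -/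
theorem isSmoothVectorField_liouvilleVF : IsSmoothVectorField W S.liouvilleVF :=
  S.contMDiff_liouvilleVF

/-- **`dφ(Y)` is a smooth function.** [folklore] -/
theorem contMDiff_dφ_liouvilleVF :
    ContMDiff (𝓡∂ 4) 𝓘(ℝ, ℝ) ∞ fun x => S.dφ x (S.liouvilleVF x) :=
  contMDiff_mlineDeriv_section (I := 𝓡∂ 4) S.φ_smooth S.contMDiff_liouvilleVF

omit [T2Space W] in
/-- The regular set `{dφ ≠ 0}` is open. [folklore] -/
theorem isOpen_setOf_dφ_ne_zero : IsOpen {x : W | S.dφ x ≠ 0} :=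
  isOpen_setOf_mfderiv_ne_zero S.φ_smooth

/-- **The normalised Liouville field is smooth off the critical set.** [folklore] -/
theorem contMDiffOn_normLiouvilleVF :
    ContMDiffOn (𝓡∂ 4) ((𝓡∂ 4).prod 𝓘(ℝ, E4)) ∞
      (fun x => (TotalSpace.mk' E4 x (S.normLiouvilleVF x) : TangentBundle (𝓡∂ 4) W))
      {x | S.dφ x ≠ 0} := by
  have hg : ContMDiffOn (𝓡∂ 4) 𝓘(ℝ, ℝ) ∞ (fun x => (S.dφ x (S.liouvilleVF x))⁻¹) {x | S.dφ x ≠ 0} :=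
    fun x hx => ((S.contMDiff_dφ_liouvilleVF x).contMDiffWithinAt).inv₀
      ((S.dφ_liouvilleVF_ne_zero_iff x).2 hx)
  exact hg.smul_section S.contMDiff_liouvilleVF.contMDiffOn

/-! ### §4 The flow-out input of the normalised Liouville field -/

omit [T2Space W] in
/-- The smooth cut-off `χ(t) = smoothTransition ((t - a) / (b - a))` (`= 0` on `(-∞, a]`, `= 1`
on `[b, ∞)` for `a < b`; Mathlib's `Real.smoothTransition` rescaled) is smooth. [folklore] -/
theorem contDiff_smoothTransition_rescale (a b : ℝ) :
    ContDiff ℝ ∞ fun t : ℝ => Real.smoothTransition ((t - a) / (b - a)) :=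
  Real.smoothTransition.contDiff.comp ((contDiff_id.sub contDiff_const).div_const _)

omit [T2Space W] in
/-- The rescaled smooth transition vanishes for `t ≤ a` (`a < b`). [folklore] -/
theorem smoothTransition_rescale_of_le {a b t : ℝ} (hab : a < b) (ht : t ≤ a) :
    Real.smoothTransition ((t - a) / (b - a)) = 0 :=
  Real.smoothTransition.zero_of_nonpos (div_nonpos_of_nonpos_of_nonneg (by linarith) (by linarith))

omit [T2Space W] in
/-- The rescaled smooth transition is `1` for `b ≤ t` (`a < b`). [folklore] -/
theorem smoothTransition_rescale_of_ge {a b t : ℝ} (hab : a < b) (ht : b ≤ t) :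
    Real.smoothTransition ((t - a) / (b - a)) = 1 :=
  Real.smoothTransition.one_of_one_le ((one_le_div (by linarith)).2 (by linarith))

/-- **The cut-off normalised Liouville field** `ξ = -(χ(φ) / dφ(Y)) • Y = -χ(φ) • Z`, with
`χ(t) = smoothTransition ((t - c₀) / (c₁ - c₀))`: it vanishes below `c₀` and is `-Z` on
`{φ ≥ c₁}`; the sign makes it point *into* `W` along `∂W` (`dφ(ξ) = -1` there), as required of
a flow-out field for `f = max φ - φ`.
[cite: MilnorHCobordism1965, proof of Thm. 3.4] -/
def cutLiouvilleVF (c₀ c₁ : ℝ) (x : W) : E4 :=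
  (-(Real.smoothTransition ((S.φ x - c₀) / (c₁ - c₀)) * (S.dφ x (S.liouvilleVF x))⁻¹)) •
    S.liouvilleVF x

/-- On `{φ ≥ c₁}` the cut-off field is `-Z`. [folklore] -/
theorem cutLiouvilleVF_eq_neg {c₀ c₁ : ℝ} (hc : c₀ < c₁) {x : W} (hx : c₁ ≤ S.φ x) :
    S.cutLiouvilleVF c₀ c₁ x = -S.normLiouvilleVF x := by
  rw [cutLiouvilleVF, smoothTransition_rescale_of_ge hc hx, one_mul, neg_smul, normLiouvilleVF]

/-- Below `c₀` the cut-off field vanishes. [folklore] -/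
theorem cutLiouvilleVF_eq_zero {c₀ c₁ : ℝ} (hc : c₀ < c₁) {x : W} (hx : S.φ x ≤ c₀) :
    S.cutLiouvilleVF c₀ c₁ x = 0 := by
  rw [cutLiouvilleVF, smoothTransition_rescale_of_le hc hx, zero_mul, neg_zero, zero_smul]

/-- **The cut-off field is smooth** when `φ` has no critical point of value `≥ c₀`: its
coefficient `-(χ(φ) · dφ(Y)⁻¹)` is smooth on the open regular set (where `dφ(Y) ≠ 0`) and
vanishes identically on the open set `{φ < c₀}`, and these two sets cover `W`. [folklore] -/
theorem contMDiff_cutLiouvilleVF {c₀ c₁ : ℝ} (hc : c₀ < c₁)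
    (hreg : ∀ x, c₀ ≤ S.φ x → S.dφ x ≠ 0) :
    ContMDiff (𝓡∂ 4) ((𝓡∂ 4).prod 𝓘(ℝ, E4)) ∞
      (fun x => (TotalSpace.mk' E4 x (S.cutLiouvilleVF c₀ c₁ x) : TangentBundle (𝓡∂ 4) W)) := by
  -- the coefficient is a smooth function
  have hcoef : ContMDiff (𝓡∂ 4) 𝓘(ℝ, ℝ) ∞
      (fun x => -(Real.smoothTransition ((S.φ x - c₀) / (c₁ - c₀)) *
        (S.dφ x (S.liouvilleVF x))⁻¹)) := by
    intro x₁
    by_cases h : S.dφ x₁ ≠ 0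
    · -- on the regular set both factors are smooth
      have h1 : ContMDiffAt (𝓡∂ 4) 𝓘(ℝ, ℝ) ∞
          (fun x => Real.smoothTransition ((S.φ x - c₀) / (c₁ - c₀))) x₁ :=
        ((contDiff_smoothTransition_rescale c₀ c₁).contMDiff.comp S.φ_smooth) x₁
      have h2 : ContMDiffAt (𝓡∂ 4) 𝓘(ℝ, ℝ) ∞ (fun x => (S.dφ x (S.liouvilleVF x))⁻¹) x₁ :=
        (S.contMDiff_dφ_liouvilleVF x₁).inv₀ ((S.dφ_liouvilleVF_ne_zero_iff x₁).2 h)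
      exact (h1.mul h2).neg
    · -- near a critical point the coefficient vanishes identically
      push Not at h
      have hlt : S.φ x₁ < c₀ := by
        by_contra hle
        exact hreg x₁ (not_lt.1 hle) h
      have hV : {x : W | S.φ x < c₀} ∈ 𝓝 x₁ :=
        (isOpen_lt S.φ_smooth.continuous continuous_const).mem_nhds hlt
      refine (contMDiffAt_const (c := (0 : ℝ))).congr_of_eventuallyEq ?_
      filter_upwards [hV] with x hx
      show -(Real.smoothTransition ((S.φ x - c₀) / (c₁ - c₀)) * (S.dφ x (S.liouvilleVF x))⁻¹) = 0
      rw [smoothTransition_rescale_of_le hc hx.le, zero_mul, neg_zero]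
  exact hcoef.smul_section S.contMDiff_liouvilleVF

/-- **`dφ(ξ) = -1` on `{φ ≥ c₁}`** for the cut-off field (there `ξ = -Z` and `dφ(Z) = 1`).
[folklore] -/
theorem dφ_cutLiouvilleVF {c₀ c₁ : ℝ} (hc : c₀ < c₁) (hreg : ∀ x, c₀ ≤ S.φ x → S.dφ x ≠ 0)
    {x : W} (hx : c₁ ≤ S.φ x) : S.dφ x (S.cutLiouvilleVF c₀ c₁ x) = -1 := by
  rw [S.cutLiouvilleVF_eq_neg hc hx, map_neg, S.dφ_normLiouvilleVF (hreg x (hc.le.trans hx))]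

omit [T2Space W] in
/-- The differential of `max φ - φ` is `-dφ`. [folklore] -/
theorem mfderiv_sSup_sub_φ_apply (x : W) (v : E4) :
    mfderiv (𝓡∂ 4) 𝓘(ℝ, ℝ) (fun z => sSup (range S.φ) - S.φ z) x v = -S.dφ x v := by
  have hφ : MDifferentiableAt (𝓡∂ 4) 𝓘(ℝ, ℝ) S.φ x := (S.φ_smooth x).mdifferentiableAt (by simp)
  have h : HasMFDerivAt (𝓡∂ 4) 𝓘(ℝ, ℝ) (fun z => sSup (range S.φ) - S.φ z) x (-(S.dφ x)) := by
    have h1 := ((hasMFDerivAt_const (I := 𝓡∂ 4) (I' := 𝓘(ℝ, ℝ)) (sSup (range S.φ)) x).sub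
      hφ.hasMFDerivAt).congr_mfderiv (zero_sub _)
    exact h1
  rw [h.mfderiv]
  rfl

/-- **The flow-out input of the normalised Liouville field.**  Given `c₀ < c₁ < max φ` with no
critical point of `φ` of value `≥ c₀`: boundary-defining function `f = max φ - φ` (smooth,
`≥ 0`, `= 0` exactly on `∂W = {φ = max φ}`), field `ξ = -χ(φ) • Z` (`contMDiff_cutLiouvilleVF`),
and `ξ(f) = -dφ(ξ) = 1` on `{f ≤ δ}`, `δ = max φ - c₁` (`dφ_cutLiouvilleVF`).  Its flow-out
(`FlowoutInput.Cover.Fl`, `BoundaryFlowout.lean`) moves `∂W` down through the levels of `φ` at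
unit speed along `-Z`. [cite: MilnorHCobordism1965, proof of Thm. 3.4] -/
def liouvilleFlowout {c₀ c₁ : ℝ} (hc : c₀ < c₁) (hc₁ : c₁ < sSup (range S.φ))
    (hreg : ∀ x, c₀ ≤ S.φ x → S.dφ x ≠ 0) : FlowoutInput 3 W where
  f z := sSup (range S.φ) - S.φ z
  ξ := S.cutLiouvilleVF c₀ c₁
  δ := sSup (range S.φ) - c₁
  δ_pos := sub_pos.2 hc₁
  f_smooth := contMDiff_const.sub S.φ_smooth
  f_nonneg z := sub_nonneg.2 (S.φ_le_sSup z)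
  f_eq_zero_iff z := by
    rw [sub_eq_zero, eq_comm]
    exact (S.boundary_eq z).symm
  ξ_smooth := S.contMDiff_cutLiouvilleVF hc hreg
  mlineDeriv_f_ξ z hz := by
    have hz' : c₁ ≤ S.φ z := by
      change sSup (range S.φ) - S.φ z ≤ sSup (range S.φ) - c₁ at hz
      linarith
    rw [mlineDeriv_def, S.mfderiv_sSup_sub_φ_apply, S.dφ_cutLiouvilleVF hc hreg hz', neg_neg]

/-- The boundary-defining function of `liouvilleFlowout` is `max φ - φ`. [folklore] -/
@[simp] theorem liouvilleFlowout_f {c₀ c₁ : ℝ} (hc : c₀ < c₁) (hc₁ : c₁ < sSup (range S.φ))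
    (hreg : ∀ x, c₀ ≤ S.φ x → S.dφ x ≠ 0) (z : W) :
    (S.liouvilleFlowout hc hc₁ hreg).f z = sSup (range S.φ) - S.φ z := rfl

/-- The field of `liouvilleFlowout` is the cut-off normalised Liouville field. [folklore] -/
@[simp] theorem liouvilleFlowout_ξ {c₀ c₁ : ℝ} (hc : c₀ < c₁) (hc₁ : c₁ < sSup (range S.φ))
    (hreg : ∀ x, c₀ ≤ S.φ x → S.dφ x ≠ 0) :
    (S.liouvilleFlowout hc hc₁ hreg).ξ = S.cutLiouvilleVF c₀ c₁ := rfl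

/-- The width of `liouvilleFlowout` is `max φ - c₁`. [folklore] -/
@[simp] theorem liouvilleFlowout_δ {c₀ c₁ : ℝ} (hc : c₀ < c₁) (hc₁ : c₁ < sSup (range S.φ))
    (hreg : ∀ x, c₀ ≤ S.φ x → S.dφ x ≠ 0) :
    (S.liouvilleFlowout hc hc₁ hreg).δ = sSup (range S.φ) - c₁ := rfl

/-- **On the region `{φ ≥ c₁}` the flow-out field is exactly `-Z`**, so that there
`dφ(ξ) = -1`, `λ(ξ) = 0` and `ω(ξ, w) = -dφ(Y)⁻¹ λ(w)`. [folklore] -/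
theorem liouvilleFlowout_ξ_eq {c₀ c₁ : ℝ} (hc : c₀ < c₁) (hc₁ : c₁ < sSup (range S.φ))
    (hreg : ∀ x, c₀ ≤ S.φ x → S.dφ x ≠ 0) {x : W} (hx : c₁ ≤ S.φ x) :
    (S.liouvilleFlowout hc hc₁ hreg).ξ x = -S.normLiouvilleVF x :=
  S.cutLiouvilleVF_eq_neg hc hx

omit [T2Space W] in
/-- **Existence of the parameters**: there are `c₀ < c₁ < max φ` with no critical point of `φ`
of value `≥ c₀`, and `c₁` may be taken as close to `max φ` as desired (any `c₁` in
`(c₀, max φ)` works). [folklore] -/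
theorem exists_liouvilleFlowout_params :
    ∃ c₀ < sSup (range S.φ), ∀ x, c₀ ≤ S.φ x → S.dφ x ≠ 0 :=
  S.exists_lt_sSup_forall_mfderiv_ne_zero

end SteinStructure

end Literature.Geometry.Symplectic

end
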